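import Mathlib
import HarnessLib
import HarnessLib.Audit
import Summits.Parity.Statement

/-!
Route: ParityCode

CLOSED (retired) 2026-08-15T13:50:15Z by operator:999:1257524 — reason: not-a-thesis: assembly does not conclude the sub-problem Statement — note: D-0027 §2.1 audit (human 2026-08-15: routes that do not decide the summit are removed): the assembly concludes `PosDensPlus`, not the sub-problem statement; a NEW conforming route may be opened from the same idea (generated `closes : … → _root_.BatemanHorn`).. The file is kept as the record of this route; refuted decls are indexed as negative knowledge (`ledger negatives`).

# Route ParityCode — one-bit Chowla(+) on n²+1 without λ — the all-ones word is far from the parity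
code of n²+1 (g-uniform positive density)

It suffices to show X = ClaimPlus: there are c > 0 and X₀ such that for every X ≥ X₀ and EVERY
completely multiplicative
g : ℕ → {±1} ("fake Liouville") one has #{n ≤ X : g(n²+1) = +1} ≥ c·X. DECLARED RUNG ROUTE: the
Assembly ends in the
route's own target PosDensPlus — positive lower density of {n : λ(n²+1) = +1} — which is OPEN
(Teravainen2024 Cor 2.1 gives
≫ x for both signs only when P splits into linear factors over ℚ; both signs occur infinitely often
by Teravainen2024 Thm 2.3
(k = 1) and Srinivasan2022 (all X²+D), after BorweinChoiGanguli2013; the known floor for +1 is ≫ √X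
from the k = 1 identity) and sits strictly BELOW crux PolyChowla
(stmt-Parity-0872, route PolynomialMobius) at f = X²+1. X does NOT imply BatemanHorn; its value for
the summit is a first
positive-density parity statement along an irreducible quadratic, a λ-free formulation with
computable kill criteria, and
an exact admissibility test for every heuristic model of λ(n²+1). Realises card
parity-code-claim-plus (F1 = CodeDuality,
F2 = DistanceIsTransversal, CLAIM+ = ClaimPlus, P3 = OddRelationsLinear) and files the theorem-track
layer H1/T1 of the
companion card composition-triples-one-bit-chowla (CompositionLaw, TripleFloor) as support.
Lean: `∃ c : ℝ, 0 < c ∧ ∃ X₀ : ℕ, ∀ X : ℕ, X₀ ≤ X → ∀ g : ℕ → ℤ, (∀ a b : ℕ, g (a * b) = g a * g b)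
→ (∀ n : ℕ, 0 < n → g n = 1 ∨ g n = -1) → c * (X : ℝ) ≤ (((Finset.Icc 1 X).filter (fun n : ℕ => g (n
^ 2 + 1) = 1)).card : ℝ)`

## Assembly
Pure logic, proved sorry-free as an `example` in Sketch.lean: λ = ArithmeticFunction.liouville is
completely multiplicative
(Mathlib `ArithmeticFunction.liouville_apply_mul`) with values (−1)^Ω(n) ∈ {±1} for n ≥ 1, so
ClaimPlus instantiated at
g := λ is PosDensPlus with the same c, X₀. The other items feed ClaimPlus: OddRelationsLinear →
ClaimPlus (OddRelationsToClaim);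
DistanceIsTransversal/CodeDuality give the g-free form refuters and provers work with;
TwoCoreOfSmooth ∘ SmoothValuesDensity
certifies the overdetermination premise; TripleFloor/CompositionLaw are the unconditional floor.
RUNG: the chain ends in the
route's target PosDensPlus (as CubicRoots ends in CubicBH), not in BatemanHorn.

Rationale: WHY THIS LINE. A sign pattern s on [1,X] satisfies ∏_{n∈S} s(n) = +1 for every S with ∏_{n∈S}(n²+1)
a perfect square iff s = g∘f for a
completely multiplicative ±1-valued g (CodeDuality: linear algebra over 𝔽₂ on the exponent-parity
vectors of n²+1), so the
worst-case number of plus signs of a fake Liouville is the Hamming distance of the all-ones word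
from the parity code 𝒞_X, and
— new here — it equals EXACTLY the transversal number of the hypergraph of ODD-cardinality square
relations
(DistanceIsTransversal): ClaimPlus is a statement about the divisor incidences of n²+1 alone, in
which λ never appears.
Two engines are imported: (i) random XOR-SAT / LDPC structure theory (DuboisMandler2002,
PittelSorkin2015, SipserSpielman1996)
— primes p > 2X are free variables (one value each), the 2X-smooth block (positive density:
Dartyge1996, Harman2008) is a
parity system with ≍ X equations in ≍ X/log X unknowns whose 2-core is extensive (TwoCoreOfSmooth:
peeling removes at most
π(2X)+1 values), and overdetermined systems are satisfiable only up to a constant fraction unless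
structured; (ii) LP duality
with Gauss composition on the line Im z = 1 as the source of short dual codewords: (n+i)(n+k−i) =
k(n+k′+i) gives
f(n)f(n+k) = k²f(n+k′) (CompositionLaw), ≍ X odd 3-relations inside [1,X] and the unconditional
floor X^{1−o(1)} for every
fake Liouville (TripleFloor, NairTenenbaum1998 for the (log X)³ form); positive density by
certificates needs ≫ X disjoint odd
relations (OddRelationsLinear), which the Erdős–Schinzel/Ford window law (Tenenbaum1990, Ford2008)
forbids for triples alone.
No prior route of Parity/BatemanHorn (AsymptoticSieve, MinorArcs, PolynomialMobius, CubicRoots,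
UnimodularColumns,
SelbergDelange) touches sign DENSITY along n²+1; all are mean-zero / asymptotic statements.

RANKED CRUXES. #0 PosDensPlus (target) — positive lower density of n with λ(n²+1) = +1: ∃ c > 0, X₀
with #{n ≤ X : λ(n²+1) = 1} ≥ cX for all X ≥ X₀ (the one-sided positive-density rung of Chowla's
conjecture for X²+1; Teräväinen's §3.4 territory). (why it might fail: Open (arXiv:2010.07924 §3.4);
the only avenue offered here is g-uniform (ClaimPlus), which is stronger than needed and could be
false while PosDensPlus is true — λ-specific input would then be required.) [Teravainen2024,
arXiv:2010.07924, BorweinChoiGanguli2013 = doi:10.4153/cmb-2011-166-9, Srinivasan2022 =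
doi:10.1090/proc/15939]
#2 ClaimPlus (crux) — CLAIM+ of card parity-code-claim-plus: uniformly over all completely
multiplicative g : ℕ → {±1}, #{n ≤ X : g(n²+1) = +1} ≥ cX for X ≥ X₀ (c, X₀ absolute). Equivalent
(DistanceIsTransversal) to: every U ⊆ [1,X] with |U| < cX is avoided by some odd-cardinality S ⊆
[1,X] with ∏_{n∈S}(n²+1) a square. Heuristic constant: c = (1 − log 2)(1 − θ*) where θ* = max
satisfiable fraction of the 2X-smooth block; size-threshold rules give θ* ≥ 0.578 (this session),
local search 0.65 at X = 2·10⁵ (card). [difficulty: open-problem] (why it might fail: A fake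
Liouville tuned to X might satisfy all but o(X) parity equations of the 2X-smooth block:
size-threshold rules already satisfy 0.58 of it (Dickman model), local search 0.65 at X=2·10⁵ and
not yet flat; root arithmetic (n ≡ ±ν_p mod p) could push this to 1−o(1).) [Teravainen2024,
arXiv:2010.07924, PittelSorkin2015 = doi:10.1017/s0963548315000097, DuboisMandler2002 =
doi:10.1109/sfcs.2002.1182002, BorweinChoiGanguli2013 = doi:10.4153/cmb-2011-166-9,
arXiv:2202.08767]
#3 OddRelationsLinear (crux) — ν_odd(X) ≫ X (card P3, the dual/LP avenue): for X ≥ X₀ there are ≥ cX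
pairwise DISJOINT odd-cardinality sets S ⊆ [1,X] with ∏_{n∈S}(n²+1) a perfect square. Each such S
contains a plus sign of every fake Liouville, so this implies ClaimPlus with the same c
(OddRelationsToClaim). Since Σ|S| ≤ X, linearly many disjoint relations have bounded size on
average: the content is that bounded-size odd relations NOT anchored at window vertices (symmetric
differences of composition triples sharing their tops) cover a positive fraction of [1,X].
[difficulty: XL] (why it might fail: Linear packing forces bounded sizes (Σ|S| ≤ X); every
bounded-size odd square-relation may be anchored at a vertex v with a divisor of v²+1 in a
bounded-ratio window — a set of density (log X)^(−0.086+o(1)) → 0 by the Ford/Tenenbaum window law —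
giving ν_odd = o(X).) [Ford2008 = arXiv:math/0401223, Tenenbaum1990 = doi:10.1007/bf01234418,
NairTenenbaum1998, BorweinChoiGanguli2013 = doi:10.4153/cmb-2011-166-9]
#9 OddRelationsToClaim (support) — glue: OddRelationsLinear → ClaimPlus (for each S: ∏_{n∈S} g(n²+1)
= g(m²) = g(m)² = 1 with |S| odd forces a +1 in S; disjoint S give distinct n; same c). [difficulty:
provable-now] [BorweinChoiGanguli2013 = doi:10.4153/cmb-2011-166-9]
#9 DistanceIsTransversal (support) — F2 made exact: ClaimPlus ↔ (∃ c > 0, X₀: ∀ X ≥ X₀, every U ⊆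
[1,X] with |U| < cX is avoided by an odd S ⊆ [1,X] ∖ U with ∏_{n∈S}(n²+1) a square), with the same
c. (←) an odd square-relation of minus signs is impossible; (→) if [1,X] ∖ U carries no odd
relation, CodeDuality applied to A = [1,X] ∖ U with s ≡ −1 yields a fake Liouville that is −1 off U.
So dist(𝟙, 𝒞_X) = transversal number of the odd-relation hypergraph, exactly. [difficulty: M]
[SipserSpielman1996 = doi:10.1109/18.556667, arXiv:2010.07924]
#9 CodeDuality (support) — F1 (labellings = fake Liouvilles), finite linear algebra over 𝔽₂: for
every finite A ⊂ ℕ and every s : A → {±1} with ∏_{n∈S} s(n) = 1 whenever S ⊆ A and ∏_{n∈S}(n²+1) is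
a square, there is a completely multiplicative g : ℕ → {±1} (g(0) ∈ {0,1}) with s(n) = g(n²+1) on A.
Proof: s is a well-defined 𝔽₂-linear functional on the span of the exponent-parity vectors r(n);
extend to 𝔽₂^P and read off g(p). [difficulty: M] [SipserSpielman1996 = doi:10.1109/18.556667]
#9 TwoCoreOfSmooth (support) — the parity system has an extensive 2-core (XOR-SAT language; a
NECESSARY condition for ClaimPlus, since all peeled equations can be satisfied by reverse-order
assignment): if the 2X-smooth values of n²+1 have positive lower density (antecedent =
SmoothValuesDensity verbatim), then for X ≥ X₀ there is C ⊆ [1,X], |C| ≥ cX, such that every prime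
occurring to an odd power in n²+1 for some n ∈ C occurs to an odd power in m²+1 for another m ∈ C.
Proof (pure counting): peel the smooth block; each removal is charged to a prime ≤ 2X whose
odd-count is exactly 1 and drops to 0 for good, so #removals ≤ π(2X)+1 = o(X) (Mathlib:
Nat.primeCounting'_add_le with a primorial modulus + divergence of Σ 1/p, or any Chebyshev bound).
[difficulty: M] [PittelSorkin2015 = doi:10.1017/s0963548315000097, DuboisMandler2002 =
doi:10.1109/sfcs.2002.1182002]
#9 SmoothValuesDensity (support) — positive lower density of n ≤ X such that every prime factor of
n²+1 is ≤ 2X (Dartyge 1996: P⁺(n²+1) < n^α for a positive proportion of n, every α > 149/179; Harman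
2008: α > 4/5; α = 1 suffices here). A published theorem (Teräväinen's "property S" for quadratics,
Prop 2.11); formalising it is a project (Gaussian integers / Harman's sieve) — provers may instead
propose it as a Literature cite fact, after which TwoCoreOfSmooth discharges. [difficulty: XL]
[Dartyge1996 = doi:10.1007/bf00053694, Harman2008 = doi:10.1007/s00013-007-2404-z, Teravainen2024
(Prop 2.11)]
#9 TripleFloor (support) — companion theorem T1 in its cite-free form: for every ε > 0 and X ≥
X₀(ε), EVERY completely multiplicative g : ℕ → {±1} has ≥ X^{1−ε} values n ≤ X with g(n²+1) = +1.
Proof: composition triples {ν, ν+(ν²+1)/d, ν+d} ⊂ [1,X] for 3 ≤ d ≤ X/2, ν² ≡ −1 (mod d), 0 < ν < d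
are ≫ X many by an elementary count (coprime a > b ≥ 1 of opposite parity with d = a²+b² ≤ X/2 give
distinct pairs (d, ν ≡ a·b⁻¹ mod d)), each contains a +1 (CompositionLaw), and a point lies in ≤
2.5·τ(v²+1) ≤ X^{ε/2} triples (divisor bound). With NairTenenbaum1998 (Στ(n²+1)² ≪ X log³X) and
Cauchy–Schwarz the floor is ≫ X/(log X)³. [difficulty: L] [BorweinChoiGanguli2013 =
doi:10.4153/cmb-2011-166-9, NairTenenbaum1998, Hooley1964]
#9 CompositionLaw (support) — Gauss composition on the line Im z = 1 (companion H1): k·k′ = n²+1 ⇒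
(n²+1)((n+k)²+1) = k²((n+k′)²+1) — from (n+i)(n+k−i) = k(n+k′+i); hence g(f(n))g(f(n+k))g(f(n+k′)) =
+1 for every fake Liouville. Checked: `linear_combination` over ℤ closes it (Sketch.lean).
[difficulty: provable-now] [BorweinChoiGanguli2013 = doi:10.4153/cmb-2011-166-9]

TWO-LAYER PLAN. Foreseen glued splits (nothing filed now): ClaimPlus ⇐ FractionalOddPacking (a
fractional packing of odd square-relations of
total weight ≥ cX) → DistanceIsTransversal-type glue → ClaimPlus, if the integral packing
OddRelationsLinear dies but the LP
value survives; ClaimPlus ⇐ EnumeratorBound (first-moment/union bound over the 2^{π(2X)/2} fake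
Liouvilles of the smooth
block against the signed relation enumerator W_X(τ) = Σ_{S ∈ 𝒞_X^⊥} (−τ)^{|S|}) → SmoothBlockClaim →
ClaimPlus (the primal
avenue); OddRelationsLinear ⇐ WindowFreeOddSets (≫ X disjoint odd Δ-combinations of ≤ 3 composition
triples avoiding all top
vertices) → OddRelationsLinear; TripleFloor ⇐ TripleCount (Σ_{d ≤ X/2} ρ(d) ≫ X/log X) →
TripleMultiplicity (≤ 2.5 τ(v²+1))
→ TripleFloor.

KILL CRITERIA. ClaimPlus REFUTED (a sequence of fake Liouvilles g_X with o(X) plus signs on [1,X],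
e.g. an explicit size/residue-structured
construction with proof) ⇒ `close --reason refuted:ClaimPlus`: the census then records that positive
density of λ(n²+1) = +1
needs λ-specific input, and PosDensPlus survives only as a target for other lines.
OddRelationsLinear refuted (bounded-size odd
relations cover o(X)) ⇒ PIVOT, not close: restate r3 as the fractional packing or drop the dual
avenue and expand the primal one
(Two-layer plan); the refuting theorem is itself a publishable window-law result.
SmoothValuesDensity is a published theorem —
a stall there breaks nothing (TwoCoreOfSmooth is conditional on it verbatim). PolyChowla
(stmt-Parity-0872) or PolyMobiusAtom
proved for X²+1 ⇒ PosDensPlus moot (density 1/2) ⇒ close superseded (ClaimPlus keeps independent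
interest as a g-uniform
statement). Numerics as evidence, not verdict: if exact MaxSAT optima on the 2X-smooth block
INCREASE toward 1 with X (card:
local search 0.67 at 10⁴ → 0.645 at 2·10⁵, decreasing), flag ClaimPlus for a refuter construction.

NOT DECOMPOSED YET. Constants (the value of c; the model says c ≤ 0.13); the −1 side for λ
(λ-specific: Pell seeds, Machin/(1+i)-coset
certificates give only X^{o(1)} — companion T3/H5(b)); general monic/irreducible quadratics and
degree d ≥ 3 (the absorbed card
fake-liouville-floor-rho-d's floor ρ(d)/2 needs positive density of X-smooth CUBIC values, open);
the 𝔽_q[u] analogue of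
ClaimPlus (same code, possibly provable by geometric means; not typed); the primal first-moment
avenue and the weight
distribution of 𝒞_X^⊥ (layer-2 children of ClaimPlus once r3 or the numerics decide); the Ford-order
sharpening of TripleFloor
((log X)³ → (log X)^{0.086}(log log X)^{3/2}, a window-law theorem for n²+1 at y ≍ n);
NairTenenbaum1998 and Dartyge1996/Harman2008
as Literature cite facts (provers/grounders propose them when they reach TripleFloor's log-form or
SmoothValuesDensity).

CHEAPEST FALSIFIER. (1) Exact ILP/MaxSAT of the 2X-smooth block for X ≤ 3000 and local search to 10⁷
(card P5): an optimum satisfied fraction that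
exceeds 0.95 and INCREASES with X kills ClaimPlus in practice (current data: 0.67 → 0.645,
decreasing). (2) For r3: for X =
10⁵…10⁶ count the n ≤ X covered by odd symmetric differences of ≤ 3 composition triples that avoid
all top vertices; if the
covered fraction decays like the top-vertex fraction, OddRelationsLinear is dead on arrival. (3)
Lookup that would make the
cruxes `known`: a paper bounding max_g #{n ≤ X : g(P(n)) = v} for an irreducible quadratic P
uniformly in completely
multiplicative g — none found (queries under Novelty). Run by me this session (folder
scratch/dickman_parity.py, pd_opt.py):
Dickman/Poisson–Dirichlet quadrature and Monte-Carlo search over size-structured fake Liouvilles: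
best 0.578 of the smooth block
(single threshold g(p) = −1 iff p > X^{0.70}; 20-cell size rules do not beat 0.58) ⇒ the card's
predicted limit (1+log 2)/2 =
0.847 for c₋* is too low (≥ 0.871 heuristically) and was NOT filed, but no size rule approaches 1,
consistent with ClaimPlus.

NUMBERS. Free block (n²+1 with a prime factor > 2X, one value per prime): density → log 2 = 0.693
HEURISTICALLY (not a theorem: the
local law of P⁺(n²+1) above X is shrinking-target root equidistribution, open); measured 0.60–0.62
at X ≤ 2·10⁵ (card), as
log(log X²/log 2X) predicts. Smooth block: 1 − log 2 = 0.307 heuristic; positive lower density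
PROVED (Dartyge1996: α > 149/179
= 0.832; Harman2008: α > 4/5). Fake Liouvilles on the smooth block: parity-of-n rule (g(2) = −1,
else +1) satisfies 1/2;
size-threshold rule 0.578 (Dickman model, this session); local search 0.67 (X = 10⁴), 0.645 (X =
2·10⁵) (card); hence
0.866 ≤ c₋*(X) measured, c₋* ≥ 0.871 predicted, and ClaimPlus's c ≤ (1 − log 2)(1 − θ*) ≤ 0.13 in
the model. Certificates:
disjoint composition triples certify 0.067X plus signs at X = 8·10⁵ (card) but provably X^{1−o(1)}
(TripleFloor; (log X)⁻³ with
NairTenenbaum1998) and asymptotically at most #tops = o(X) (window law; Ford's δ = 1 − (1+log log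
2)/log 2 = 0.086, exponent
3/2). Relation module: dim 𝒞^⊥ = 862 ≈ 0.29X at X = 3000; composition triples span 786/862 (triples
inside [1,3000]) and
851/862 (inside [1,24000]) (card F1). Items at open: 11 (target 1, cruxes 2, support 7, assembly 1).

DEFINITION REQUESTS. None: every statement is over Mathlib (ArithmeticFunction.liouville,
Finset.filter/card, IsSquare, Odd, padicValNat,
Set.PairwiseDisjoint, Real.rpow); Sketch.lean elaborates with rc 0 and proves Assembly and
CompositionLaw as examples. Cite
facts provers will want later (not filed now, no decl needed at open): NairTenenbaum1998 class bound
Στ(n²+1)² ≪ X log³X (for the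
log-form of TripleFloor); Dartyge1996 / Harman2008 smooth values of n²+1 (= SmoothValuesDensity);
Tenenbaum1990 window law for
polynomial values (acquisition acq-02456 filed — paywalled).

Novelty: Searches (2026-08-15): `lit search "completely multiplicative function values at quadratic
polynomial n^2+1 sign positive
lower density"` (local searchd rc 75, down); `lit galaxy search "Liouville function at polynomial
arguments" --star all` (1 hit,
Frantzikinakis–Klurman–Moreira, unrelated), `"Liouville function n^2+1" --star all` (0), `"sign
changes of the Liouville
function on quadratics" --star all` (0), galaxy bm25 pdf "completely multiplicative function value
−1 at n²+1 / sign patterns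
of Liouville along irreducible quadratics" (15 rows, noise); zbMATH: "Liouville function polynomial
arguments" (9; Teräväinen
2024, Kravitz–Woo–Xu 2025 random polynomials), "Erdős Schinzel divisors of F(n) in an interval
polynomial" (2: Tenenbaum 1990
I/II), "Polynomial values free of large prime factors" (DMT 2001); Crossref: BCG 2013 / Srinivasan
2022 / Ford 2008 /
Pittel–Sorkin 2015 / Dubois–Mandler 2002 / Dartyge 1996 / Harman 2008 (all located, DOIs cited);
arXiv API 429. Read:
arXiv:2010.07924 pp. 4, 5, 7 (Cor 2.1, Conj 2.5, Thm 2.10, Prop 2.11, Problems 3.1–3.2); Ford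
arXiv:math/0401223 (grep: no
polynomial-value version). Plus the two cards' own documented searches and triage 15-0/18-0 (zbMATH
×4, arXiv ×2, citing graphs
of arXiv:1109.3107 and arXiv:2010.07924).
Nearest prior art found: Teravainen2024 = arXiv:2010.07924 (Thm 2.10: pretentious g along P with
property S have limsup |mean|
≤ 1 − δ, per g; Cor 2.1 both signs ≫ x only for split P; Conjecture 2.5 qualitative); BorweinC  [refs: 2010.07924, math/0401223, 1109.3107, 2202.08767, 0811.0372, Teravainen2024]

Barriers (technique_class: parity-code max-xor-sat lp-duality disjoint-certificates): - technique_class: parity-code max-xor-sat lp-duality disjoint-certificates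
- Literature.Barriers.Parity.SelbergParityBarrier: evaded for what is claimed — no statement here is
derived from Type-I data of a sifted sequence; ClaimPlus/OddRelationsLinear use exact multiplicative
relations among VALUES of n²+1 (square products), which Selberg's twins 1 ± λ(n) do not see, and the
target is one bit of positive density, not a prime count or o(x) cancellation; honest limit: nothing
here bears on ∑ λ(n²+1) = o(x).
- Literature.Barriers.Parity.FordMaynardLowLevel: not a Type-I/II argument, so nothing to evade;
conversely TripleFloor exhibits sign information on the thin set {n²+1} (c = 1/2, no Type-II range)
that the Ford–Maynard impossibility does not cover.
- Literature.Barriers.Parity.FordFixedLevelBarrier: does not apply — no level-of-distribution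
hypothesis is used anywhere in the route.
- Literature.Barriers.Parity.MatomakiRadziwillTao2015_counterexample: respected — the route never
asserts o(x) for non-pretentious g along n²+1 (false by free primes, card free-tail-anti-elliott);
ClaimPlus is the g-uniform residue (a floor c·X of plus signs), the correct shape after that
counterexample family.
- Literature.Barriers.Parity.FunctionFieldMobiusBias: consistent — over 𝔽_q[u] the same code and the
same composition certificates exist and force plus signs for every g; CCG's biased μ(f(g)) for
inseparable f is a codeword with density ≠ 1/2, a warning only against upgrading PosDensPlus t

Novelty grade: new-combination — route-review grade (refuter rreview-63142eff-0; route retired 13:50Z §2.1 — PosDensPlus ⊬ BatemanHorn, = this review's structural objection; full review = route evidence REVIEW-ParityCode.md): new-combination = coding/XOR-SAT duality for fake-Liouville sign counts (Sipser–Spielman, Dubois–Mandler, P (refuter refuter-rreview-route-Parity-TwoCMLines--63142eff-0, 2026-08-15T13:58:18Z; prior: arXiv:2010.07924, doi:10.4153/cmb-2011-166-9, doi:10.1090/proc/15939, doi:10.1109/18.556667, doi:10.1017/s0963548315000097, arXiv:math/0401223)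

History (route lifecycle, newest last):
- 2026-08-15T13:50:16Z · CLOSED retired — not-a-thesis: assembly does not conclude the sub-problem Statement (operator:999:1257524)

sub-problem: BatemanHorn · status: closed(retired) · opened planner-plancard-Parity-BatemanHorn-parity-co-b15edd5e-0 2026-08-15T12:27:28Z · rev 0 · ledger route-Parity-ParityCode
GENERATED by the gate from the ledger (D-0016/17). Provers cite these decls: `theorem foo : Summit.Parity.BatemanHorn.Theses.ParityCode.<Decl> := …` in Summits/Parity/BatemanHorn/Theorems/<Name>.lean.
-/

namespace Summit.Parity.BatemanHorn.Theses.ParityCode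

open scoped BigOperators Topology Manifold Classical MeasureTheory ProbabilityTheory Matrix InnerProductSpace ComplexConjugate ContinuousMap
open Filter Set Function TopologicalSpace MeasureTheory

attribute [summit_statement] _root_.BatemanHorn

/-- item stmt-Parity-8084 · target · rank 0 · closed · moot by None · by planner
why it might fail: Open (arXiv:2010.07924 §3.4); the only avenue offered here is g-uniform (ClaimPlus), which is stronger than needed and could be false while PosDensPlus is true — λ-specific input would then be required.
sources: Teravainen2024, arXiv:2010.07924, BorweinChoiGanguli2013 = doi:10.4153/cmb-2011-166-9, Srinivasan2022 = doi:10.1090/proc/15939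
[target] positive lower density of n with λ(n²+1) = +1: ∃ c > 0, X₀ with #{n ≤ X : λ(n²+1) = 1} ≥ cX
for all X ≥ X₀ (the one-sided positive-density rung of Chowla's conjecture for X²+1; Teräväinen's
§3.4 territory). -/
@[route_item "route-Parity-ParityCode"]
def PosDensPlus : Prop :=
  ∃ c : ℝ, 0 < c ∧ ∃ X₀ : ℕ, ∀ X : ℕ, X₀ ≤ X → c * (X : ℝ) ≤ (((Finset.Icc 1 X).filter (fun n : ℕ => ArithmeticFunction.liouville (n ^ 2 + 1) = 1)).card : ℝ)

/-- item stmt-Parity-8085 · crux · rank 2 · closed · moot by None · by planner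
why it might fail: A fake Liouville tuned to X might satisfy all but o(X) parity equations of the 2X-smooth block: size-threshold rules already satisfy 0.58 of it (Dickman model), local search 0.65 at X=2·10⁵ and not yet flat; root arithmetic (n ≡ ±ν_p mod p) could push this to 1−o(1).
sources: Teravainen2024, arXiv:2010.07924, PittelSorkin2015 = doi:10.1017/s0963548315000097, DuboisMandler2002 = doi:10.1109/sfcs.2002.1182002, BorweinChoiGanguli2013 = doi:10.4153/cmb-2011-166-9, arXiv:2202.08767
[crux] CLAIM+ of card parity-code-claim-plus: uniformly over all completely multiplicative g : ℕ →
{±1}, #{n ≤ X : g(n²+1) = +1} ≥ cX for X ≥ X₀ (c, X₀ absolute). Equivalent (DistanceIsTransversal)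
to: every U ⊆ [1,X] with |U| < cX is avoided by some odd-cardinality S ⊆ [1,X] with ∏_{n∈S}(n²+1) a
square. Heuristic constant: c = (1 − log 2)(1 − θ*) where θ* = max satisfiable fraction of the
2X-smooth block; size-threshold rules give θ* ≥ 0.578 (this session), local search 0.65 at X = 2·10⁵
(card). [difficulty: open-problem] -/
@[route_item "route-Parity-ParityCode"]
def ClaimPlus : Prop :=
  ∃ c : ℝ, 0 < c ∧ ∃ X₀ : ℕ, ∀ X : ℕ, X₀ ≤ X → ∀ g : ℕ → ℤ, (∀ a b : ℕ, g (a * b) = g a * g b) → (∀ n : ℕ, 0 < n → g n = 1 ∨ g n = -1) → c * (X : ℝ) ≤ (((Finset.Icc 1 X).filter (fun n : ℕ => g (n ^ 2 + 1) = 1)).card : ℝ)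

/-- item stmt-Parity-8086 · crux · rank 3 · closed · moot by None · by planner
why it might fail: Linear packing forces bounded sizes (Σ|S| ≤ X); every bounded-size odd square-relation may be anchored at a vertex v with a divisor of v²+1 in a bounded-ratio window — a set of density (log X)^(−0.086+o(1)) → 0 by the Ford/Tenenbaum window law — giving ν_odd = o(X).
sources: Ford2008 = arXiv:math/0401223, Tenenbaum1990 = doi:10.1007/bf01234418, NairTenenbaum1998, BorweinChoiGanguli2013 = doi:10.4153/cmb-2011-166-9
[crux] ν_odd(X) ≫ X (card P3, the dual/LP avenue): for X ≥ X₀ there are ≥ cX pairwise DISJOINT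
odd-cardinality sets S ⊆ [1,X] with ∏_{n∈S}(n²+1) a perfect square. Each such S contains a plus sign
of every fake Liouville, so this implies ClaimPlus with the same c (OddRelationsToClaim). Since Σ|S|
≤ X, linearly many disjoint relations have bounded size on average: the content is that bounded-size
odd relations NOT anchored at window vertices (symmetric differences of composition triples sharing
their tops) cover a positive fraction of [1,X]. [difficulty: XL] -/
@[route_item "route-Parity-ParityCode"]
def OddRelationsLinear : Prop :=
  ∃ c : ℝ, 0 < c ∧ ∃ X₀ : ℕ, ∀ X : ℕ, X₀ ≤ X → ∃ F : Finset (Finset ℕ), (∀ S ∈ F, S ⊆ Finset.Icc 1 X ∧ Odd S.card ∧ IsSquare (∏ n ∈ S, (n ^ 2 + 1))) ∧ (F : Set (Finset ℕ)).PairwiseDisjoint id ∧ c * (X : ℝ) ≤ (F.card : ℝ)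

/-- item stmt-Parity-8087 · support · rank 9 · closed · moot by None · by planner
sources: BorweinChoiGanguli2013 = doi:10.4153/cmb-2011-166-9
[support] glue: OddRelationsLinear → ClaimPlus (for each S: ∏_{n∈S} g(n²+1) = g(m²) = g(m)² = 1 with
|S| odd forces a +1 in S; disjoint S give distinct n; same c). [difficulty: provable-now] -/
@[route_item "route-Parity-ParityCode"]
def OddRelationsToClaim : Prop :=
  OddRelationsLinear → ClaimPlus

/-- item stmt-Parity-8088 · support · rank 9 · closed · moot by None · by planner
sources: SipserSpielman1996 = doi:10.1109/18.556667, arXiv:2010.07924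
[support] F2 made exact: ClaimPlus ↔ (∃ c > 0, X₀: ∀ X ≥ X₀, every U ⊆ [1,X] with |U| < cX is
avoided by an odd S ⊆ [1,X] ∖ U with ∏_{n∈S}(n²+1) a square), with the same c. (←) an odd
square-relation of minus signs is impossible; (→) if [1,X] ∖ U carries no odd relation, CodeDuality
applied to A = [1,X] ∖ U with s ≡ −1 yields a fake Liouville that is −1 off U. So dist(𝟙, 𝒞_X) =
transversal number of the odd-relation hypergraph, exactly. [difficulty: M] -/
@[route_item "route-Parity-ParityCode"]
def DistanceIsTransversal : Prop :=
  (∃ c : ℝ, 0 < c ∧ ∃ X₀ : ℕ, ∀ X : ℕ, X₀ ≤ X → ∀ g : ℕ → ℤ, (∀ a b : ℕ, g (a * b) = g a * g b) → (∀ n : ℕ, 0 < n → g n = 1 ∨ g n = -1) → c * (X : ℝ) ≤ (((Finset.Icc 1 X).filter (fun n : ℕ => g (n ^ 2 + 1) = 1)).card : ℝ)) ↔ (∃ c : ℝ, 0 < c ∧ ∃ X₀ : ℕ, ∀ X : ℕ, X₀ ≤ X → ∀ U : Finset ℕ, U ⊆ Finset.Icc 1 X → (U.card : ℝ) < c * (X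 : ℝ) → ∃ S : Finset ℕ, S ⊆ Finset.Icc 1 X \ U ∧ Odd S.card ∧ IsSquare (∏ n ∈ S, (n ^ 2 + 1)))

/-- item stmt-Parity-8089 · support · rank 9 · closed · moot by None · by planner
sources: SipserSpielman1996 = doi:10.1109/18.556667
[support] F1 (labellings = fake Liouvilles), finite linear algebra over 𝔽₂: for every finite A ⊂ ℕ
and every s : A → {±1} with ∏_{n∈S} s(n) = 1 whenever S ⊆ A and ∏_{n∈S}(n²+1) is a square, there is
a completely multiplicative g : ℕ → {±1} (g(0) ∈ {0,1}) with s(n) = g(n²+1) on A. Proof: s is a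
well-defined 𝔽₂-linear functional on the span of the exponent-parity vectors r(n); extend to 𝔽₂^P
and read off g(p). [difficulty: M] -/
@[route_item "route-Parity-ParityCode"]
def CodeDuality : Prop :=
  ∀ A : Finset ℕ, ∀ s : ℕ → ℤ, (∀ n ∈ A, s n = 1 ∨ s n = -1) → (∀ S : Finset ℕ, S ⊆ A → IsSquare (∏ n ∈ S, (n ^ 2 + 1)) → ∏ n ∈ S, s n = 1) → ∃ g : ℕ → ℤ, (∀ a b : ℕ, g (a * b) = g a * g b) ∧ (∀ n : ℕ, 0 < n → g n = 1 ∨ g n = -1) ∧ ∀ n ∈ A, s n = g (n ^ 2 + 1)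

/-- item stmt-Parity-8090 · support · rank 9 · closed · moot by None · by planner
sources: PittelSorkin2015 = doi:10.1017/s0963548315000097, DuboisMandler2002 = doi:10.1109/sfcs.2002.1182002
[support] the parity system has an extensive 2-core (XOR-SAT language; a NECESSARY condition for
ClaimPlus, since all peeled equations can be satisfied by reverse-order assignment): if the
2X-smooth values of n²+1 have positive lower density (antecedent = SmoothValuesDensity verbatim),
then for X ≥ X₀ there is C ⊆ [1,X], |C| ≥ cX, such that every prime occurring to an odd power in
n²+1 for some n ∈ C occurs to an odd power in m²+1 for another m ∈ C. Proof (pure counting): peel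
the smooth block; each removal is charged to a prime ≤ 2X whose odd-count is exactly 1 and drops to
0 for good, so #removals ≤ π(2X)+1 = o(X) (Mathlib: Nat.primeCounting'_add_le with a primorial
modulus + divergence of Σ 1/p, or any Chebyshev bound). [difficulty: M] -/
@[route_item "route-Parity-ParityCode"]
def TwoCoreOfSmooth : Prop :=
  (∃ c₀ : ℝ, 0 < c₀ ∧ ∃ X₀ : ℕ, ∀ X : ℕ, X₀ ≤ X → c₀ * (X : ℝ) ≤ (((Finset.Icc 1 X).filter (fun n : ℕ => ∀ p : ℕ, p.Prime → p ∣ n ^ 2 + 1 → p ≤ 2 * X)).card : ℝ)) → ∃ c : ℝ, 0 < c ∧ ∃ X₀ : ℕ, ∀ X : ℕ, X₀ ≤ X → ∃ C : Finset ℕ, C ⊆ Finset.Icc 1 X ∧ c * (X : ℝ) ≤ (C.card : ℝ) ∧ ∀ n ∈ C, ∀ p : ℕ, p.Prime → Odd (padicValNat p (n ^ 2 + 1)) → ∃ m ∈ C, m ≠ n ∧ Odd (padicValNat p (m ^ 2 + 1))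

/-- item stmt-Parity-8091 · support · rank 9 · closed · moot by None · by planner
sources: Dartyge1996 = doi:10.1007/bf00053694, Harman2008 = doi:10.1007/s00013-007-2404-z, Teravainen2024 (Prop 2.11)
[support] positive lower density of n ≤ X such that every prime factor of n²+1 is ≤ 2X (Dartyge
1996: P⁺(n²+1) < n^α for a positive proportion of n, every α > 149/179; Harman 2008: α > 4/5; α = 1
suffices here). A published theorem (Teräväinen's "property S" for quadratics, Prop 2.11);
formalising it is a project (Gaussian integers / Harman's sieve) — provers may instead propose it as
a Literature cite fact, after which TwoCoreOfSmooth discharges. [difficulty: XL] -/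
@[route_item "route-Parity-ParityCode"]
def SmoothValuesDensity : Prop :=
  ∃ c₀ : ℝ, 0 < c₀ ∧ ∃ X₀ : ℕ, ∀ X : ℕ, X₀ ≤ X → c₀ * (X : ℝ) ≤ (((Finset.Icc 1 X).filter (fun n : ℕ => ∀ p : ℕ, p.Prime → p ∣ n ^ 2 + 1 → p ≤ 2 * X)).card : ℝ)

/-- item stmt-Parity-8092 · support · rank 9 · closed · moot by None · by planner
sources: BorweinChoiGanguli2013 = doi:10.4153/cmb-2011-166-9, NairTenenbaum1998, Hooley1964
[support] companion theorem T1 in its cite-free form: for every ε > 0 and X ≥ X₀(ε), EVERY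
completely multiplicative g : ℕ → {±1} has ≥ X^{1−ε} values n ≤ X with g(n²+1) = +1. Proof:
composition triples {ν, ν+(ν²+1)/d, ν+d} ⊂ [1,X] for 3 ≤ d ≤ X/2, ν² ≡ −1 (mod d), 0 < ν < d are ≫ X
many by an elementary count (coprime a > b ≥ 1 of opposite parity with d = a²+b² ≤ X/2 give distinct
pairs (d, ν ≡ a·b⁻¹ mod d)), each contains a +1 (CompositionLaw), and a point lies in ≤ 2.5·τ(v²+1)
≤ X^{ε/2} triples (divisor bound). With NairTenenbaum1998 (Στ(n²+1)² ≪ X log³X) and Cauchy–Schwarz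
the floor is ≫ X/(log X)³. [difficulty: L] -/
@[route_item "route-Parity-ParityCode"]
def TripleFloor : Prop :=
  ∀ ε : ℝ, 0 < ε → ∃ X₀ : ℕ, ∀ X : ℕ, X₀ ≤ X → ∀ g : ℕ → ℤ, (∀ a b : ℕ, g (a * b) = g a * g b) → (∀ n : ℕ, 0 < n → g n = 1 ∨ g n = -1) → (X : ℝ) ^ (1 - ε) ≤ (((Finset.Icc 1 X).filter (fun n : ℕ => g (n ^ 2 + 1) = 1)).card : ℝ)

/-- item stmt-Parity-8093 · support · rank 9 · closed · moot by None · by planner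
sources: BorweinChoiGanguli2013 = doi:10.4153/cmb-2011-166-9
[support] Gauss composition on the line Im z = 1 (companion H1): k·k′ = n²+1 ⇒ (n²+1)((n+k)²+1) =
k²((n+k′)²+1) — from (n+i)(n+k−i) = k(n+k′+i); hence g(f(n))g(f(n+k))g(f(n+k′)) = +1 for every fake
Liouville. Checked: `linear_combination` over ℤ closes it (Sketch.lean). [difficulty: provable-now] -/
@[route_item "route-Parity-ParityCode"]
def CompositionLaw : Prop :=
  ∀ n k k' : ℕ, k * k' = n ^ 2 + 1 → (n ^ 2 + 1) * ((n + k) ^ 2 + 1) = k ^ 2 * ((n + k') ^ 2 + 1)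

/-- item stmt-Parity-8094 · assembly · rank 1 · closed · moot by None · by planner
sources: Teravainen2024, Chowla1965
[assembly] ClaimPlus → PosDensPlus (instantiate the fake Liouville g := λ). -/
@[route_item "route-Parity-ParityCode"]
def Assembly : Prop :=
  ClaimPlus → PosDensPlus

end Summit.Parity.BatemanHorn.Theses.ParityCode
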